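import Literature.Barriers.CriticalPhenomena.SubexponentialGrowthZd
import Literature.Probability.Percolation.PercolationProofs
import Literature.Probability.Percolation.InequalitiesProofs
import Literature.Probability.Percolation.ConnectivityContinuityProofs
import Mathlib.Order.ConditionallyCompleteLattice.Finset
import Mathlib.Order.Filter.Finite
import Mathlib.Analysis.SpecificLimits.Basic
import HarnessLib

/-!
# Hutchcroft 2016, Thm. 2 (`κ_{p_c}(n) ≤ gr(G)^{-n}`): proof from finite subcritical susceptibility

(Proofs for `SubexponentialGrowthZd.lean`.)

Barrier catalogue `Literature/Barriers/CriticalPhenomena/`, sibling proof file of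
`SubexponentialGrowthZd.lean`, where the named fact `Hutchcroft2016_connectivityDecay`
(T. Hutchcroft, *C. R. Math. Acad. Sci. Paris* 354 (2016) 944–947, Thm. 2) is stated. We
formalise §2 of that note:

* **Lemma 4** ("Let `G` be any graph. Then `κ_p(n)` is a supermultiplicative function of `n`"):
  `kappa_mul_le_kappa_add`, from Harris's inequality (`Literature.Probability.Percolation.harris_fkg_holds`) applied
  to `{u ↔ w} ∩ {w ↔ v} ⊆ {u ↔ v}` with `w` the `m`-th vertex of a walk of length `≤ m + n`
  from `u` to `v`; iterated form `kappa_pow_le`.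
* **Lemma 5** (left continuity in `p`, in the pointwise form the proof of Thm. 2 uses): for a
  quasi-transitive graph, `κ_p(n)` is the minimum of the finitely many lower semicontinuous
  functions `p ↦ τ_p(a, b)`, `a ∈ V₀`, `b ∈ B(a, n)` (`kappa_eq_real_openConn_of_repPairs`,
  automorphism invariance `real_openConn_iso` and `lowerSemicontinuous_real_openConn` of
  `ConnectivityContinuityProofs.lean`), so an upper bound valid for all `p < p_c` persists at
  `p_c` (`kappa_criticalProb_le`).
* **Theorem 6** (Aizenman–Barsky 1987 for transitive graphs, Antunović–Veselić 2008, Thm. 2, for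
  quasi-transitive graphs: `Σ_x τ_p(ρ, x) < ∞` for every `p < p_c`) is vendored here as the named
  fact `AntunovicVeselic2008_finiteSusceptibility`. STATUS (2026-08-15): DISCHARGED downstream, as
  `AntunovicVeselic2008_finiteSusceptibility_holds` in the sibling
  `SubexponentialGrowthZdDischarge.lean` (p18874), from the port of the Duminil-Copin–Tassion
  proof to quasi-transitive graphs
  (`Literature.Probability.Percolation.DCTQ.summable_real_openConn_of_lt_criticalProb`,
  `Literature/Probability/Percolation/SharpnessQuasiTransitive{,MeanField,Susceptibility,Proofs}.lean`);
  the discharge lives in a separate module because this file declares the named fact (a `def`).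
* **Proof of Thm. 2**: `κ_p(n)·|B(ρ, n)| ≤ Σ_{x ∈ B(ρ,n)} τ_p(ρ, x) ≤ Σ_x τ_p(ρ, x)`
  (`kappa_mul_ballVolume_le_tsum`); with Lemma 4 in the form `κ_p(n)^j ≤ κ_p(jn)` this gives
  `(κ_p(n) bⁿ)^j ≤ χ(p)` for every `b < gr(G)` and all large `j`, hence `κ_p(n) ≤ b^{-n}` and
  `κ_p(n) ≤ gr(G)^{-n}` for `p < p_c` (`kappa_le_growthRate_rpow_neg_of_summable`; this is the
  printed Fekete step
  `sup_n κ_p(n)^{1/n} = lim_n κ_p(n)^{1/n} ≤ limsup (χ/|B(ρ,n)|)^{1/n} = gr^{-1}` unrolled, so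
  that Fekete's lemma itself is not needed); then Lemma 5.

Main results:

* `Hutchcroft2016_connectivityDecay_of_finiteSusceptibility :
    AntunovicVeselic2008_finiteSusceptibility → Hutchcroft2016_connectivityDecay` (PROVED);
* the named fact `AntunovicVeselic2008_finiteSusceptibility` (Hutchcroft's Thm. 6); its discharge
  `AntunovicVeselic2008_finiteSusceptibility_holds` and the unconditional
  `Hutchcroft2016_connectivityDecay_holds` (Thm. 2, PROVED) are in the sibling
  `SubexponentialGrowthZdDischarge.lean`, which imports this file.

Side results on the notions of `SubexponentialGrowthZd.lean`: balls of locally finite graphs are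
finite (`graphBall_finite`), connected locally finite graphs are countable
(`countable_of_connected_of_locallyFinite`), quasi-transitive locally finite graphs have bounded
degree (`IsQuasiTransitive.exists_degree_le`) and `|B(x, n)| ≤ (D+1)^n`
(`ballVolume_le_pow_of_degree_le`), so that `1 ≤ gr(G) ≤ D + 1` is a genuine `liminf`
(`one_le_growthRate`, `eventually_pow_lt_ballVolume`).

## References

* T. Hutchcroft, *Critical percolation on any quasi-transitive graph of exponential growth has
  no infinite clusters*, C. R. Math. Acad. Sci. Paris 354 (2016) 944–947 (arXiv:1605.05301),
  Thm. 2, Lemmas 4–5, Thm. 6 and the proof of Thm. 2 (§2). [Hutchcroft2016]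
* T. Antunović, I. Veselić, *Sharpness of the phase transition and exponential decay of the
  subcritical cluster size for percolation on quasi-transitive graphs*, J. Stat. Phys. 130
  (2008) 983–1009 (arXiv:0707.1089), Thm. 2 (`p_T = p_H`). [AntunovicVeselic2007]
* M. Aizenman, D. J. Barsky, *Sharpness of the phase transition in percolation models*,
  Comm. Math. Phys. 108 (1987) 489–526. [AizenmanBarsky1987]
* T. E. Harris, Proc. Camb. Phil. Soc. 56 (1960), Lemma 4.1 (Harris's inequality).
-/

noncomputable section

namespace Literature.Barriers.CriticalPhenomena

open MeasureTheory Filter Topology Literature.Probability.LatticeModels Literature.Probability.Percolation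

variable {V : Type*}

/-! ### Balls of locally finite graphs -/

/-- `B(x, 0) = {x}`. [folklore] -/
theorem graphBall_zero (G : SimpleGraph V) (x : V) : graphBall G x 0 = {x} := by
  ext y
  simp only [graphBall, Set.mem_setOf_eq, Set.mem_singleton_iff, Nat.le_zero]
  constructor
  · rintro ⟨w, hw⟩
    exact (SimpleGraph.Walk.eq_of_length_eq_zero hw).symm
  · rintro rfl
    exact ⟨SimpleGraph.Walk.nil, rfl⟩

/-- `B(x, n+1) = {x} ∪ ⋃_{v ∼ x} B(v, n)` (first-step decomposition of a walk). [folklore] -/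
theorem graphBall_succ (G : SimpleGraph V) (x : V) (n : ℕ) :
    graphBall G x (n + 1) = {x} ∪ ⋃ v ∈ G.neighborSet x, graphBall G v n := by
  ext y
  simp only [graphBall, Set.mem_union, Set.mem_singleton_iff, Set.mem_iUnion,
    SimpleGraph.mem_neighborSet, Set.mem_setOf_eq, exists_prop]
  constructor
  · rintro ⟨w, hw⟩
    cases w with
    | nil => exact Or.inl rfl
    | cons h w' =>
      refine Or.inr ⟨_, h, w', ?_⟩
      simp only [SimpleGraph.Walk.length_cons] at hw
      omega
  · rintro (rfl | ⟨v, hv, w, hw⟩)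
    · exact ⟨SimpleGraph.Walk.nil, Nat.zero_le _⟩
    · exact ⟨SimpleGraph.Walk.cons hv w, by rw [SimpleGraph.Walk.length_cons]; omega⟩

/-- Balls of a locally finite graph are finite. [folklore] -/
theorem graphBall_finite (G : SimpleGraph V) [G.LocallyFinite] (x : V) (n : ℕ) :
    (graphBall G x n).Finite := by
  induction n generalizing x with
  | zero => rw [graphBall_zero]; exact Set.finite_singleton x
  | succ n ih =>
    rw [graphBall_succ]
    exact (Set.finite_singleton x).union
      (Set.Finite.biUnion (G.neighborSet x).toFinite fun v _ => ih v)

/-- `1 ≤ |B(x, n)|` (`x ∈ B(x, n)`, a finite set). [folklore] -/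
theorem one_le_ballVolume (G : SimpleGraph V) [G.LocallyFinite] (x : V) (n : ℕ) :
    1 ≤ ballVolume G x n := by
  rw [ballVolume, Nat.one_le_iff_ne_zero, Ne, Set.ncard_eq_zero (graphBall_finite G x n)]
  exact fun h => (Set.eq_empty_iff_forall_notMem.1 h) x (mem_graphBall_self G x n)

/-- A connected, locally finite graph has countably many vertices (`V = ⋃_n B(x, n)`).
("which we will always assume to be connected and locally finite", Hutchcroft 2016, §1.)
[folklore] -/
theorem countable_of_connected_of_locallyFinite (G : SimpleGraph V) [G.LocallyFinite]
    (h : G.Connected) (x : V) : Countable V := by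
  have hsub : (Set.univ : Set V) ⊆ ⋃ n : ℕ, graphBall G x n := by
    intro y _
    obtain ⟨w⟩ := h.preconnected x y
    exact Set.mem_iUnion.2 ⟨w.length, w, le_rfl⟩
  have hc : (Set.univ : Set V).Countable :=
    (Set.countable_iUnion fun n => (graphBall_finite G x n).countable).mono hsub
  exact Set.countable_univ_iff.1 hc

/-- Graph automorphisms map balls to balls: `y ∈ B(x, n) → γ y ∈ B(γ x, n)`. [folklore] -/
theorem mem_graphBall_map {G : SimpleGraph V} (γ : G ≃g G) {x y : V} {n : ℕ}
    (h : y ∈ graphBall G x n) : γ y ∈ graphBall G (γ x) n := by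
  obtain ⟨w, hw⟩ := h
  exact ⟨w.map γ.toHom, by rw [SimpleGraph.Walk.length_map]; exact hw⟩

/-! ### Quasi-transitive graphs: bounded degree, `|B(x,n)| ≤ (D+1)^n`, `1 ≤ gr(G)` -/

/-- A locally finite quasi-transitive graph has bounded degree (degrees are constant on each of
the finitely many `Aut(G)`-orbits). [folklore] -/
theorem IsQuasiTransitive.exists_degree_le {G : SimpleGraph V} [G.LocallyFinite]
    (h : IsQuasiTransitive G) : ∃ D : ℕ, ∀ v, G.degree v ≤ D := by
  obtain ⟨V₀, hV₀⟩ := h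
  refine ⟨V₀.sup fun v => G.degree v, fun v => ?_⟩
  obtain ⟨γ, hγ⟩ := hV₀ v
  rw [← γ.degree_eq v]
  exact Finset.le_sup (f := fun v => G.degree v) hγ

/-- `ncard` of a finite indexed union is at most the sum of the `ncard`s. [folklore] -/
theorem ncard_biUnion_le {ι : Type*} (s : Finset ι) (t : ι → Set V) :
    (⋃ i ∈ s, t i).ncard ≤ ∑ i ∈ s, (t i).ncard := by
  classical
  induction s using Finset.induction_on with
  | empty => simp
  | insert a s ha ih =>
    rw [Finset.set_biUnion_insert, Finset.sum_insert ha]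
    exact (Set.ncard_union_le _ _).trans (Nat.add_le_add_left ih _)

/-- **Volume growth under a degree bound**: if every degree is `≤ D` then `|B(x, n)| ≤ (D+1)^n`.
[folklore] -/
theorem ballVolume_le_pow_of_degree_le (G : SimpleGraph V) [G.LocallyFinite] {D : ℕ}
    (hD : ∀ v, G.degree v ≤ D) (x : V) (n : ℕ) : ballVolume G x n ≤ (D + 1) ^ n := by
  induction n generalizing x with
  | zero => simp [ballVolume, graphBall_zero]
  | succ n ih =>
    have hU : (⋃ v ∈ G.neighborSet x, graphBall G v n) =
        ⋃ v ∈ G.neighborFinset x, graphBall G v n := by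
      simp only [SimpleGraph.mem_neighborFinset, SimpleGraph.mem_neighborSet]
    rw [ballVolume, graphBall_succ, hU]
    calc ({x} ∪ ⋃ v ∈ G.neighborFinset x, graphBall G v n).ncard
        ≤ ({x} : Set V).ncard + (⋃ v ∈ G.neighborFinset x, graphBall G v n).ncard :=
          Set.ncard_union_le _ _
      _ ≤ 1 + ∑ v ∈ G.neighborFinset x, (graphBall G v n).ncard := by
          rw [Set.ncard_singleton]
          exact Nat.add_le_add_left (ncard_biUnion_le _ _) 1
      _ ≤ 1 + ∑ _v ∈ G.neighborFinset x, (D + 1) ^ n :=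
          Nat.add_le_add_left (Finset.sum_le_sum fun v _ => ih v) 1
      _ = 1 + G.degree x * (D + 1) ^ n := by
          rw [Finset.sum_const, smul_eq_mul, SimpleGraph.card_neighborFinset_eq_degree]
      _ ≤ 1 + D * (D + 1) ^ n := by
          have := Nat.mul_le_mul_right ((D + 1) ^ n) (hD x); omega
      _ ≤ (D + 1) ^ (n + 1) := by
          have h1 : 1 ≤ (D + 1) ^ n := Nat.one_le_pow _ _ (Nat.succ_pos D)
          rw [pow_succ]
          nlinarith

/-- The sequence `|B(x, n)|^{1/n}` is `≥ 1` termwise. [folklore] -/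
theorem one_le_ballVolume_rpow (G : SimpleGraph V) [G.LocallyFinite] (x : V) (n : ℕ) :
    (1 : ℝ) ≤ (ballVolume G x n : ℝ) ^ (1 / (n : ℝ)) :=
  Real.one_le_rpow (by exact_mod_cast one_le_ballVolume G x n) (by positivity)

/-- Under a degree bound `D`, `|B(x, n)|^{1/n} ≤ D + 1`. [folklore] -/
theorem ballVolume_rpow_le_of_degree_le (G : SimpleGraph V) [G.LocallyFinite] {D : ℕ}
    (hD : ∀ v, G.degree v ≤ D) (x : V) (n : ℕ) :
    (ballVolume G x n : ℝ) ^ (1 / (n : ℝ)) ≤ (D + 1 : ℝ) := by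
  rcases Nat.eq_zero_or_pos n with rfl | hn
  · simp
  · have h1 : (ballVolume G x n : ℝ) ≤ ((D + 1 : ℝ)) ^ n := by
      exact_mod_cast ballVolume_le_pow_of_degree_le G hD x n
    calc (ballVolume G x n : ℝ) ^ (1 / (n : ℝ)) ≤ (((D + 1 : ℝ)) ^ n) ^ (1 / (n : ℝ)) :=
          Real.rpow_le_rpow (by positivity) h1 (by positivity)
      _ = D + 1 := by
          rw [one_div]
          exact Real.pow_rpow_inv_natCast (by positivity) hn.ne'

/-- **`gr(G) ≥ 1`** for a locally finite graph of bounded degree (the `liminf` of a sequence in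
`[1, D+1]`). [cite: HeydenreichVanDerHofstad2017, (15.6.6)] -/
theorem one_le_growthRate (G : SimpleGraph V) [G.LocallyFinite] {D : ℕ}
    (hD : ∀ v, G.degree v ≤ D) (x : V) : 1 ≤ growthRate G x :=
  le_liminf_of_le (isCoboundedUnder_ge_of_le atTop (ballVolume_rpow_le_of_degree_le G hD x))
    (Eventually.of_forall (one_le_ballVolume_rpow G x))

/-- **Below the growth rate the balls are eventually large**: if `0 < b < gr(G)` then
`b^k < |B(x, k)|` for all large `k` (definition of `liminf`). [cite: Hutchcroft2016, §1 (gr(G))] -/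
theorem eventually_pow_lt_ballVolume (G : SimpleGraph V) [G.LocallyFinite] (x : V) {b : ℝ}
    (hb0 : 0 < b) (hb : b < growthRate G x) :
    ∀ᶠ k : ℕ in atTop, b ^ k < (ballVolume G x k : ℝ) := by
  have hev : ∀ᶠ k : ℕ in atTop, b < (ballVolume G x k : ℝ) ^ (1 / (k : ℝ)) :=
    eventually_lt_of_lt_liminf hb (isBoundedUnder_of ⟨1, fun k => one_le_ballVolume_rpow G x k⟩)
  filter_upwards [hev, eventually_ge_atTop 1] with k hk hk1
  have hk0 : k ≠ 0 := Nat.one_le_iff_ne_zero.1 hk1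
  calc b ^ k < ((ballVolume G x k : ℝ) ^ (1 / (k : ℝ))) ^ k := pow_lt_pow_left₀ hk hb0.le hk0
    _ = ballVolume G x k := by
        rw [one_div]; exact Real.rpow_inv_natCast_pow (by positivity) hk0

/-- A vertex of a graph of exponential growth has a neighbour (otherwise `B(x, n) = {x}` for all
`n`). [folklore] -/
theorem exists_adj_of_hasExponentialGrowth (G : SimpleGraph V) [G.LocallyFinite]
    (h : HasExponentialGrowth G) (x : V) : ∃ y, G.Adj x y := by
  by_contra hno
  push Not at hno
  have hball : ∀ n, graphBall G x n = {x} := by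
    intro n
    induction n with
    | zero => exact graphBall_zero G x
    | succ n ih =>
      rw [graphBall_succ]
      have : G.neighborSet x = ∅ := Set.eq_empty_iff_forall_notMem.2 fun y hy => hno y hy
      simp [this]
  obtain ⟨c, hc, hev⟩ := h x
  obtain ⟨n, hn, hn1⟩ := (hev.and (eventually_ge_atTop 1)).exists
  have hvol : (ballVolume G x n : ℝ) = 1 := by simp [ballVolume, hball n]
  rw [hvol] at hn
  exact absurd hn (not_le.2 (one_lt_pow₀ hc (Nat.one_le_iff_ne_zero.1 hn1)))

/-! ### `κ_p(n)`: elementary bounds and Lemma 4 (supermultiplicativity) -/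

/-- `κ_p(n) ≤ τ_p(x, y)` whenever `d(x, y) ≤ n`. [cite: Hutchcroft2016, §1 (κ_p(n))] -/
theorem kappa_le_real_openConn (G : SimpleGraph V) (p : unitInterval) {n : ℕ} {x y : V}
    (h : y ∈ graphBall G x n) : kappa G p n ≤ (bondPercolation G p).real (openConn x y) :=
  csInf_le ⟨0, by rintro _ ⟨xy, -, rfl⟩; exact measureReal_nonneg⟩ ⟨(x, y), h, rfl⟩

/-- A uniform lower bound on `τ_p(x, y)`, `d(x, y) ≤ n`, bounds `κ_p(n)` from below.
[cite: Hutchcroft2016, §1 (κ_p(n))] -/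
theorem le_kappa [Nonempty V] (G : SimpleGraph V) (p : unitInterval) {n : ℕ} {b : ℝ}
    (h : ∀ x y, y ∈ graphBall G x n → b ≤ (bondPercolation G p).real (openConn x y)) :
    b ≤ kappa G p n := by
  obtain ⟨x⟩ := ‹Nonempty V›
  refine le_csInf ⟨_, ⟨(x, x), mem_graphBall_self G x n, rfl⟩⟩ ?_
  rintro _ ⟨xy, hxy, rfl⟩
  exact h xy.1 xy.2 hxy

/-- `κ_p(0) ≥ 1` (indeed `= 1`): the only pairs are `(x, x)` and `τ_p(x, x) = 1`. [folklore] -/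
theorem one_le_kappa_zero [Nonempty V] (G : SimpleGraph V) (p : unitInterval) :
    1 ≤ kappa G p 0 := by
  refine le_kappa G p fun x y hy => ?_
  rw [graphBall_zero, Set.mem_singleton_iff] at hy
  subst hy
  have : (openConn y y : Set (BondConfig V)) = Set.univ :=
    Set.eq_univ_of_forall fun ω => (SimpleGraph.Reachable.refl y : (openGraph ω).Reachable y y)
  rw [this, probReal_univ]

/-- **Automorphism invariance of the two-point function**: `τ_p(γ x, γ y) = τ_p(x, y)` for
`γ ∈ Aut(G)` ("The probability measure is invariant under the graph automorphisms",
Antunović–Veselić 2008, §2). [cite: AntunovicVeselic2007, §2] -/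
theorem real_openConn_iso {G : SimpleGraph V} (γ : G ≃g G) (p : unitInterval) (x y : V) :
    (bondPercolation G p).real (openConn (γ x) (γ y)) =
      (bondPercolation G p).real (openConn x y) := by
  rw [← bondPercolation_real_preimage_relabel_iso γ p (openConn (γ x) (γ y))]
  congr 1
  ext ω
  simp only [Set.mem_preimage, openConn, Set.mem_setOf_eq]
  let ψ : openGraph ω ≃g openGraph (BondConfig.relabel (sym2Equiv γ.toEquiv) ω) :=
    { toEquiv := γ.toEquiv
      map_rel_iff' := fun {a b} => openGraph_relabel_adj_iff γ.toEquiv ω a b }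
  exact ψ.reachable_iff

/-- **Hutchcroft 2016, Lemma 4** ("Let `G` be any graph. Then `κ_p(n)` is a supermultiplicative
function of `n`"): `κ_p(m) κ_p(n) ≤ κ_p(m + n)`. Printed proof: for `d(u, v) ≤ m + n` pick `w`
with `d(u, w) ≤ m`, `d(w, v) ≤ n`; `{u ↔ v} ⊇ {u ↔ w} ∩ {w ↔ v}` and Harris's inequality give
`τ_p(u, v) ≥ τ_p(u, w) τ_p(w, v) ≥ κ_p(m) κ_p(n)`. (Countability of `V` makes `{x ↔ y}`
measurable.) [cite: Hutchcroft2016, Lemma 4] -/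
theorem kappa_mul_le_kappa_add [Countable V] [Nonempty V] (G : SimpleGraph V) (p : unitInterval)
    (m n : ℕ) : kappa G p m * kappa G p n ≤ kappa G p (m + n) := by
  refine le_kappa G p fun u v huv => ?_
  obtain ⟨w, hw⟩ := huv
  have h1 : w.getVert m ∈ graphBall G u m :=
    ⟨w.take m, by rw [SimpleGraph.Walk.take_length]; exact min_le_left _ _⟩
  have h2 : v ∈ graphBall G (w.getVert m) n :=
    ⟨w.drop m, by rw [SimpleGraph.Walk.drop_length]; omega⟩
  calc kappa G p m * kappa G p n
      ≤ (bondPercolation G p).real (openConn u (w.getVert m)) *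
          (bondPercolation G p).real (openConn (w.getVert m) v) :=
        mul_le_mul (kappa_le_real_openConn G p h1) (kappa_le_real_openConn G p h2)
          (kappa_nonneg G p n) measureReal_nonneg
    _ ≤ (bondPercolation G p).real (openConn u (w.getVert m) ∩ openConn (w.getVert m) v) :=
        Literature.Probability.Percolation.harris_fkg_holds G p (isUpperSet_openConn u _) (isUpperSet_openConn _ v)
          (measurableSet_openConn_holds u _) (measurableSet_openConn_holds _ v)
    _ ≤ (bondPercolation G p).real (openConn u v) :=
        measureReal_mono (fun ω hω => SimpleGraph.Reachable.trans hω.1 hω.2) (measure_ne_top _ _)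

/-- Lemma 4 iterated: `κ_p(n)^j ≤ κ_p(j n)`. [cite: Hutchcroft2016, Lemma 4] -/
theorem kappa_pow_le [Countable V] [Nonempty V] (G : SimpleGraph V) (p : unitInterval)
    (n j : ℕ) : kappa G p n ^ j ≤ kappa G p (j * n) := by
  induction j with
  | zero => simpa using one_le_kappa_zero G p
  | succ j ih =>
    rw [pow_succ, Nat.succ_mul]
    exact (mul_le_mul_of_nonneg_right ih (kappa_nonneg G p n)).trans
      (kappa_mul_le_kappa_add G p _ _)

/-! ### The named fact: finite susceptibility below `p_c` (Hutchcroft's Thm. 6) -/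

/-- NAMED FACT — **Hutchcroft 2016, Thm. 6** ("Let `G` be a quasi-transitive graph, and let `ρ`
be a fixed vertex of `G`. Then the expected cluster size is finite for every `p < p_c`. That is,
`Σ_x τ_p(ρ, x) < ∞` for every `p < p_c`"; "proven in the transitive case by Aizenman and Barsky,
and in the quasi-transitive case by Antunović and Veselić"), i.e. **Antunović–Veselić 2008,
Thm. 2** ("For every quasi-transitive graph `G` we have `p_T = p_H`", with
`p_T = sup{p : E_p|C_x| < ∞}`, `p_H = sup{p : P_p(|C_x| = ∞) = 0}`, graphs "infinite, countable,
connected"), for bond percolation on a connected, locally finite, quasi-transitive graph, with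
`p_c` the tree's `criticalProb G ρ` (`= p_H` at `ρ`) and `E_p|C_ρ| = Σ_x τ_p(ρ, x)` written as
summability of `x ↦ τ_p(ρ, x)`. Discharged: `AntunovicVeselic2008_finiteSusceptibility_holds`
(sibling `SubexponentialGrowthZdDischarge.lean`, by the Duminil-Copin–Tassion proof ported to
quasi-transitive graphs; the `ℤ^d` case is also
`Literature.Probability.Percolation.DCT16.perc_sharpness_holds`). Users take
`(h : AntunovicVeselic2008_finiteSusceptibility)` and are fed the `_holds` theorem.
[cite: Hutchcroft2016, Thm. 6] [cite: AntunovicVeselic2007, Thm. 2]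
[cite: AizenmanBarsky1987, main theorem (transitive case; as cited by Hutchcroft2016, Thm. 6)] -/
def AntunovicVeselic2008_finiteSusceptibility : Prop :=
  ∀ {V : Type} (G : SimpleGraph V) [G.LocallyFinite], G.Connected → IsQuasiTransitive G →
    ∀ (ρ : V) (p : unitInterval), (p : ℝ) < criticalProb G ρ →
      Summable fun x : V => (bondPercolation G p).real (openConn ρ x)

/-! ### Proof of Thm. 2 below `p_c`: `κ_p(n) ≤ gr(G)^{-n}` from `χ(p) < ∞` -/

/-- `κ_p(m) · |B(x, m)| ≤ Σ_{y ∈ B(x,m)} τ_p(x, y) ≤ Σ_y τ_p(x, y)` (first display of the proof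
of Thm. 2). [cite: Hutchcroft2016, §2 (proof of Thm. 2)] -/
theorem kappa_mul_ballVolume_le_tsum (G : SimpleGraph V) [G.LocallyFinite] (p : unitInterval)
    (x : V) (hs : Summable fun y : V => (bondPercolation G p).real (openConn x y)) (m : ℕ) :
    kappa G p m * ballVolume G x m ≤ ∑' y, (bondPercolation G p).real (openConn x y) := by
  have hfin := graphBall_finite G x m
  calc kappa G p m * ballVolume G x m = ∑ _y ∈ hfin.toFinset, kappa G p m := by
        rw [Finset.sum_const, nsmul_eq_mul, mul_comm, ballVolume,
          Set.ncard_eq_toFinset_card _ hfin]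
    _ ≤ ∑ y ∈ hfin.toFinset, (bondPercolation G p).real (openConn x y) :=
        Finset.sum_le_sum fun y hy => kappa_le_real_openConn G p (hfin.mem_toFinset.1 hy)
    _ ≤ ∑' y, (bondPercolation G p).real (openConn x y) :=
        hs.sum_le_tsum _ fun y _ => measureReal_nonneg

/-- **Thm. 2 at a subcritical parameter** (the Fekete step of the printed proof, unrolled): on a
locally finite graph of bounded degree on countably many vertices, if `Σ_y τ_p(x, y) < ∞` then
`κ_p(n) ≤ gr(G)^{-n}` for `n ≥ 1`. Proof: for `0 < b < gr`, `b^k < |B(x, k)|` for large `k`, so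
`(κ_p(n) bⁿ)^j ≤ κ_p(jn) |B(x, jn)| ≤ χ` for large `j` (Lemma 4), forcing `κ_p(n) bⁿ ≤ 1`; let
`b ↑ gr`. [cite: Hutchcroft2016, §2 (proof of Thm. 2)] -/
theorem kappa_le_growthRate_rpow_neg_of_summable [Countable V] (G : SimpleGraph V)
    [G.LocallyFinite] {D : ℕ} (hD : ∀ v, G.degree v ≤ D) (x : V) (p : unitInterval)
    (hs : Summable fun y : V => (bondPercolation G p).real (openConn x y)) {n : ℕ} (hn : 1 ≤ n) :
    kappa G p n ≤ growthRate G x ^ (-(n : ℝ)) := by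
  haveI : Nonempty V := ⟨x⟩
  set χ : ℝ := ∑' y, (bondPercolation G p).real (openConn x y) with hχ
  -- Step 1: `κ_p(n) ≤ b^{-n}` for every `0 < b < gr(G)`.
  have key : ∀ b : ℝ, 0 < b → b < growthRate G x → kappa G p n ≤ (b ^ n)⁻¹ := by
    intro b hb0 hb
    obtain ⟨K, hK⟩ := eventually_atTop.1 (eventually_pow_lt_ballVolume G x hb0 hb)
    set t : ℝ := kappa G p n * b ^ n with ht_def
    have ht0 : 0 ≤ t := mul_nonneg (kappa_nonneg G p n) (by positivity)
    have htj : ∀ j, K ≤ j → t ^ j ≤ χ := by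
      intro j hj
      have hjn : K ≤ j * n := hj.trans (Nat.le_mul_of_pos_right j hn)
      calc t ^ j = kappa G p n ^ j * b ^ (j * n) := by
            rw [ht_def, mul_pow, ← pow_mul, mul_comm n j]
        _ ≤ kappa G p (j * n) * (ballVolume G x (j * n) : ℝ) :=
            mul_le_mul (kappa_pow_le G p n j) (hK _ hjn).le (by positivity)
              (kappa_nonneg G p _)
        _ ≤ χ := kappa_mul_ballVolume_le_tsum G p x hs _
    have ht1 : t ≤ 1 := by
      by_contra h1
      push Not at h1
      obtain ⟨j, hj1, hj2⟩ :=
        (((tendsto_pow_atTop_atTop_of_one_lt h1).eventually_gt_atTop χ).and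
          (eventually_ge_atTop K)).exists
      exact absurd (htj j hj2) (not_le.2 hj1)
    have hbn : 0 < b ^ n := by positivity
    calc kappa G p n = t * (b ^ n)⁻¹ := by rw [ht_def, mul_inv_cancel_right₀ hbn.ne']
      _ ≤ 1 * (b ^ n)⁻¹ := by gcongr
      _ = (b ^ n)⁻¹ := one_mul _
  -- Step 2: let `b ↑ gr(G)`.
  have hgr : 1 ≤ growthRate G x := one_le_growthRate G hD x
  have hgr0 : 0 < growthRate G x := one_pos.trans_le hgr
  have hcont : Tendsto (fun b : ℝ => (b ^ n)⁻¹) (𝓝[<] growthRate G x)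
      (𝓝 ((growthRate G x ^ n)⁻¹)) :=
    (((continuousAt_pow _ n).inv₀ (pow_ne_zero _ hgr0.ne')).tendsto).mono_left
      nhdsWithin_le_nhds
  have hev : ∀ᶠ b in 𝓝[<] growthRate G x, kappa G p n ≤ (b ^ n)⁻¹ := by
    have h1 : ∀ᶠ b in 𝓝[<] growthRate G x, 0 < b :=
      (eventually_gt_nhds hgr0).filter_mono nhdsWithin_le_nhds
    have h2 : ∀ᶠ b in 𝓝[<] growthRate G x, b < growthRate G x := eventually_mem_nhdsWithin
    filter_upwards [h1, h2] with b hb1 hb2 using key b hb1 hb2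
  have hle : kappa G p n ≤ (growthRate G x ^ n)⁻¹ := ge_of_tendsto hcont hev
  rw [Real.rpow_neg hgr0.le, Real.rpow_natCast]
  exact hle

/-! ### Lemma 5: the finitely many pair classes and left continuity at `p_c` -/

/-- For `V₀` a set of orbit representatives, every admissible pair `(x, y)`, `d(x, y) ≤ n`, has
the two-point function of a pair `(a, b)` with `a ∈ V₀`, `b ∈ B(a, n)` ("Since `G` is
quasi-transitive, there are only finitely many isomorphism classes of pairs of vertices at
distance at most `n`"). [cite: Hutchcroft2016, Lemma 5 (proof)] -/
theorem exists_repPair {G : SimpleGraph V} {V₀ : Finset V} (hV₀ : ∀ v : V, ∃ γ : G ≃g G, γ v ∈ V₀)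
    (p : unitInterval) {n : ℕ} {x y : V} (hxy : y ∈ graphBall G x n) :
    ∃ ab ∈ {ab : V × V | ab.1 ∈ V₀ ∧ ab.2 ∈ graphBall G ab.1 n},
      (bondPercolation G p).real (openConn ab.1 ab.2) =
        (bondPercolation G p).real (openConn x y) := by
  obtain ⟨γ, hγ⟩ := hV₀ x
  exact ⟨(γ x, γ y), ⟨hγ, mem_graphBall_map γ hxy⟩, real_openConn_iso γ p x y⟩

/-- The set of representative pairs `{(a, b) : a ∈ V₀, b ∈ B(a, n)}` is finite (balls are finite).
[cite: Hutchcroft2016, Lemma 5 (proof)] -/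
theorem repPairs_finite (G : SimpleGraph V) [G.LocallyFinite] (V₀ : Finset V) (n : ℕ) :
    {ab : V × V | ab.1 ∈ V₀ ∧ ab.2 ∈ graphBall G ab.1 n}.Finite := by
  have hsub : {ab : V × V | ab.1 ∈ V₀ ∧ ab.2 ∈ graphBall G ab.1 n} ⊆
      ⋃ a ∈ (V₀ : Set V), (fun b => (a, b)) '' graphBall G a n := by
    rintro ⟨a, b⟩ ⟨ha, hb⟩
    exact Set.mem_biUnion ha ⟨b, hb, rfl⟩
  exact (Set.Finite.biUnion V₀.finite_toSet fun a _ => (graphBall_finite G a n).image _).subset hsub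

/-- On a quasi-transitive graph `κ_p(n)` is attained: `κ_p(n) = τ_p(a, b)` for some representative
pair (`κ_p(n)` is a minimum of finitely many values). [cite: Hutchcroft2016, Lemma 5 (proof)] -/
theorem kappa_eq_real_openConn_of_repPairs [Nonempty V] (G : SimpleGraph V) [G.LocallyFinite]
    {V₀ : Finset V} (hV₀ : ∀ v : V, ∃ γ : G ≃g G, γ v ∈ V₀) (p : unitInterval) (n : ℕ) :
    ∃ ab ∈ {ab : V × V | ab.1 ∈ V₀ ∧ ab.2 ∈ graphBall G ab.1 n},
      kappa G p n = (bondPercolation G p).real (openConn ab.1 ab.2) := by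
  set f : V × V → ℝ := fun xy => (bondPercolation G p).real (openConn xy.1 xy.2) with hf
  set S : Set (V × V) := {xy | xy.2 ∈ graphBall G xy.1 n} with hS
  have hsub : f '' S ⊆ f '' {ab : V × V | ab.1 ∈ V₀ ∧ ab.2 ∈ graphBall G ab.1 n} := by
    rintro _ ⟨⟨x, y⟩, hxy, rfl⟩
    obtain ⟨ab, hab, he⟩ := exists_repPair hV₀ p hxy
    exact ⟨ab, hab, he⟩
  have hfin : (f '' S).Finite := ((repPairs_finite G V₀ n).image f).subset hsub
  obtain ⟨x⟩ := ‹Nonempty V›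
  have hne : (f '' S).Nonempty := ⟨_, (x, x), mem_graphBall_self G x n, rfl⟩
  obtain ⟨ab, hab, he⟩ := hsub (hne.csInf_mem hfin)
  exact ⟨ab, hab, he.symm⟩

/-- `τ_0(x, y) = 0` for `x ≠ y` (at `p = 0` every edge is closed). [folklore] -/
theorem real_openConn_zero [Countable V] (G : SimpleGraph V) {x y : V} (hxy : x ≠ y) :
    (bondPercolation G 0).real (openConn x y) = 0 := by
  have hmem : (∅ : BondConfig V) ∉ (openConn x y : Set (BondConfig V)) := by
    intro h
    have hbot : openGraph (∅ : BondConfig V) = ⊥ := SimpleGraph.fromEdgeSet_empty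
    change (openGraph (∅ : BondConfig V)).Reachable x y at h
    rw [hbot, SimpleGraph.reachable_bot] at h
    exact hxy h
  simp only [bondPercolation, ProbabilityTheory.setBernoulli_zero, measureReal_def,
    Measure.dirac_apply, Set.indicator_of_notMem hmem, ENNReal.toReal_zero]

/-- **Hutchcroft 2016, Lemma 5, as used** ("We conclude by applying Lemma 5"): on a
quasi-transitive graph, an upper bound `κ_p(n) ≤ g` valid for every `p < p_c` persists at
`p = p_c`. Printed proof: `τ_p(x, y)` is lower semicontinuous in `p` (a supremum of the
continuous `τ^r_p(x, y)`), `κ_p(n)` is a minimum over finitely many pair classes, hence lower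
semicontinuous, and an increasing lower semicontinuous function is left continuous. (If
`p_c = 0` there is no `p < p_c`; then `κ_0(n) = 0 ≤ g` directly, using a neighbour of `x`.)
[cite: Hutchcroft2016, Lemma 5] -/
theorem kappa_criticalProb_le [Countable V] (G : SimpleGraph V) [G.LocallyFinite]
    {V₀ : Finset V} (hV₀ : ∀ v : V, ∃ γ : G ≃g G, γ v ∈ V₀) (x : V) {n : ℕ} (hn : 1 ≤ n)
    (hadj : ∃ y, G.Adj x y) {g : ℝ} (hg : 0 ≤ g)
    (hlt : ∀ p : unitInterval, (p : ℝ) < criticalProb G x → kappa G p n ≤ g) :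
    kappa G ⟨criticalProb G x, criticalProb_mem_Icc G x⟩ n ≤ g := by
  haveI : Nonempty V := ⟨x⟩
  set p₀ : unitInterval := ⟨criticalProb G x, criticalProb_mem_Icc G x⟩ with hp₀
  rcases (criticalProb_mem_Icc G x).1.eq_or_lt with h0 | hpos
  · -- `p_c = 0`
    obtain ⟨y, hy⟩ := hadj
    have hp00 : p₀ = 0 := Subtype.ext h0.symm
    have hyB : y ∈ graphBall G x n :=
      ⟨SimpleGraph.Walk.cons hy SimpleGraph.Walk.nil, by
        rw [SimpleGraph.Walk.length_cons, SimpleGraph.Walk.length_nil]; exact hn⟩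
    calc kappa G p₀ n ≤ (bondPercolation G p₀).real (openConn x y) :=
          kappa_le_real_openConn G p₀ hyB
      _ = 0 := by rw [hp00]; exact real_openConn_zero G hy.ne
      _ ≤ g := hg
  · -- `p_c > 0`: lower semicontinuity at `p₀` of the finitely many `τ_·(a, b)`
    by_contra H
    push Not at H
    set R : Set (V × V) := {ab : V × V | ab.1 ∈ V₀ ∧ ab.2 ∈ graphBall G ab.1 n} with hR
    have hRfin : R.Finite := repPairs_finite G V₀ n
    have hR0 : ∀ ab ∈ R, g < (bondPercolation G p₀).real (openConn ab.1 ab.2) :=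
      fun ab hab => H.trans_le (kappa_le_real_openConn G p₀ hab.2)
    have hev : ∀ᶠ p : unitInterval in 𝓝 p₀,
        ∀ ab ∈ R, g < (bondPercolation G p).real (openConn ab.1 ab.2) := by
      rw [hRfin.eventually_all]
      intro ab hab
      exact lowerSemicontinuous_real_openConn G ab.1 ab.2 p₀ g (hR0 ab hab)
    obtain ⟨ε, hε, hball⟩ := Metric.eventually_nhds_iff.1 hev
    -- a parameter `q < p_c` within `ε` of `p_c`
    set δ : ℝ := min (ε / 2) (criticalProb G x) with hδ
    have hδpos : 0 < δ := lt_min (half_pos hε) hpos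
    have hδle : δ ≤ criticalProb G x := min_le_right _ _
    have hq01 : criticalProb G x - δ ∈ unitInterval :=
      ⟨by linarith, by linarith [(criticalProb_mem_Icc G x).2]⟩
    set q : unitInterval := ⟨criticalProb G x - δ, hq01⟩ with hq
    have hqlt : (q : ℝ) < criticalProb G x := by show criticalProb G x - δ < _; linarith
    have hqdist : dist q p₀ < ε := by
      rw [Subtype.dist_eq, Real.dist_eq, show (q : ℝ) - p₀ = -δ by simp [hq, hp₀], abs_neg,
        abs_of_pos hδpos]
      exact (min_le_left _ _).trans_lt (half_lt_self hε)
    have hqall := hball hqdist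
    -- `κ_q(n)` is attained at a representative pair, where it exceeds `g`
    obtain ⟨ab, hab, hk⟩ := kappa_eq_real_openConn_of_repPairs G hV₀ q n
    have h1 : g < kappa G q n := hk ▸ hqall ab hab
    exact absurd (hlt q hqlt) (not_le.2 h1)

/-! ### Assembly: Thm. 2 from Thm. 6 -/

/-- **Hutchcroft 2016, Thm. 2, from Thm. 6.** For a connected, locally finite, quasi-transitive
graph of exponential growth, finite susceptibility below `p_c`
(`AntunovicVeselic2008_finiteSusceptibility`, Hutchcroft's Thm. 6) implies
`κ_{p_c}(n) ≤ gr(G)^{-n}` for all `n ≥ 1` — the named fact `Hutchcroft2016_connectivityDecay`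
of `SubexponentialGrowthZd.lean`. Proof as printed in §2: Lemma 4, the susceptibility bound and
the (unrolled) Fekete step for `p < p_c`, then Lemma 5.
[cite: Hutchcroft2016, Thm. 2 and §2 (proof)] -/
theorem Hutchcroft2016_connectivityDecay_of_finiteSusceptibility
    (h6 : AntunovicVeselic2008_finiteSusceptibility) : Hutchcroft2016_connectivityDecay := by
  intro V G _ hconn hqt hexp x n hn
  haveI : Countable V := countable_of_connected_of_locallyFinite G hconn x
  obtain ⟨D, hD⟩ := hqt.exists_degree_le
  obtain ⟨V₀, hV₀⟩ := id hqt
  have hgr : 1 ≤ growthRate G x := one_le_growthRate G hD x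
  refine kappa_criticalProb_le G hV₀ x hn (exists_adj_of_hasExponentialGrowth G hexp x)
    (Real.rpow_nonneg (zero_le_one.trans hgr) _) fun p hp => ?_
  exact kappa_le_growthRate_rpow_neg_of_summable G hD x p (h6 G hconn hqt x p hp) hn

end Literature.Barriers.CriticalPhenomena

end
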